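import Literature.NumberTheory.GaloisRepresentations.FrameRingPoints
import Literature.AlgebraicGeometry.Resolution.CompleteFiniteness
import Mathlib.FieldTheory.IsAlgClosed.Basic
import Mathlib.RingTheory.AdicCompletion.Noetherian
import Mathlib.RingTheory.Ideal.GoingUp
import Mathlib.RingTheory.Ideal.KrullsHeightTheorem
import Mathlib.RingTheory.Ideal.MinimalPrime.Noetherian
import Mathlib.RingTheory.Localization.AtPrime.Basic
import Mathlib.RingTheory.Localization.Away.Basic
import Mathlib.RingTheory.Localization.Ideal
import HarnessLib

/-!
# `ℚ̄_p`-points separate the elements of a reduced `p`-torsion-free local `𝒪_L`-algebra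

Let `L/ℚ_p` be finite inside `ℚ̄_p`, `𝒪 = 𝒪_L` its valuation ring (a complete discrete
valuation ring with finite residue field `k_L`), and `R` a noetherian local `𝒪`-algebra whose
residue field is `k_L` (i.e. `𝒪 → R/𝔪_R` is onto), which is REDUCED and has NO `p`-TORSION.
This is the standing list of ring-theoretic axioms of the accepted interface
`PointwiseLiftingRing` ([BLGGT] §1.3–1.4: the quotients `R^□_{𝒪,ρ̄,𝒞}` of the universal lifting
ring "uniquely characterized by requiring that they are reduced without `l`-torsion and that a
`ℚ̄_l`-point … factors through [the quotient] if and only if …"). The theorem of this file is the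
piece of commutative algebra that makes "characterized by its `ℚ̄_l`-points" meaningful:

* `exists_algHom_apply_ne_zero` — **for every `r ≠ 0` in `R` there is an `𝒪`-algebra
  homomorphism `x : R → ℚ̄_p` with `x r ≠ 0`.** Equivalently (`eq_zero_of_forall_algHom_eq_zero`)
  an element killed by every `ℚ̄_p`-point is zero.

Proof (the argument behind de Jong 1995, Lemma 7.1.9 / [BLGGT] §1.3 "`R[1/l]` … its closed
points", arranged to avoid Jacobson rings): `f = r·p` is not nilpotent (`R` reduced, `p`
regular), so `R_f ≠ 0` has a maximal ideal, whose contraction `Q` is a prime of `R` with `f ∉ Q`,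
maximal among such. In the noetherian local domain `D = R/Q` every non-zero prime therefore
contains `f̄ ∈ 𝔪_D ∖ {0}`; by Krull's principal ideal theorem and prime avoidance this forces
`𝔪_D` to be the only non-zero prime (`eq_maximalIdeal_of_forall_prime_mem`), so
`𝔪_D^N ⊆ p·D ⊆ 𝔪_𝒪 D`, and the complete Nakayama lemma over the complete ring `𝒪` (accepted
`module_finite_of_isAdicComplete_of_residue_surjective`, Matsumura Thm. 8.4 / proof of 29.4)
makes `D` a FINITE `𝒪`-module. Hence `D` is an integral domain algebraic over `𝒪`, and
Mathlib's `IsAlgClosed.lift : D →ₐ[𝒪] ℚ̄_p` is injective on `D` by incomparability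
(`Ideal.eq_bot_of_comap_eq_bot`); composed with `R → D` it is a point not vanishing at `r`.

Also provided: the automatic locality of the structure map (`algebraMap_mem_maximalIdeal`,
`natCast_mem_maximalIdeal_of_residue_surjective`) and the one-dimensionality lemma
`eq_maximalIdeal_of_forall_prime_mem` for noetherian local domains. No named facts, no `sorry`.

## References

* [BLGGT] T. Barnet-Lamb, T. Gee, D. Geraghty, R. Taylor, *Potential automorphy and change of
  weight*, Ann. of Math. 179 (2014), §1.3–1.4 (pp. 12–14 of arXiv:1010.2561). [BarnetlambEtAl2014]
* A. J. de Jong, *Crystalline Dieudonné module theory via formal and rigid geometry*, Publ. IHÉS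
  82 (1995), Lemma 7.1.9.
* H. Matsumura, *Commutative Ring Theory*, CUP 1986, Thm. 8.4, Thm. 13.5 (Krull). [Matsumura1987]
-/

noncomputable section

open IsLocalRing

namespace Literature.NumberTheory.GaloisRepresentations

/-! ### Noetherian local domains in which every non-zero prime contains a fixed element -/

section OneDimensional

variable {D : Type*} [CommRing D] [IsDomain D] [IsNoetherianRing D] [IsLocalRing D]

/-- In a domain, non-zero primes have height `≥ 1`. [folklore] -/
theorem one_le_height_of_ne_bot (Q : Ideal D) [Q.IsPrime] (hQ0 : Q ≠ ⊥) : 1 ≤ Q.height := by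
  have hlt : (⊥ : Ideal D) < Q := bot_lt_iff_ne_bot.mpr hQ0
  have h := Ideal.height_strict_mono_of_isPrime_of_isPrime hlt
  exact Order.one_le_iff_pos.mpr (zero_le.trans_lt h)

/-- **One-dimensionality from a common element of the non-zero primes.** In a noetherian local
domain `D`, if some non-zero `f ∈ 𝔪_D` lies in every non-zero prime, then `𝔪_D` is the only
non-zero prime. Proof: the minimal primes `𝔭ᵢ` over `(f)` have height `1` (Krull's principal
ideal theorem); if `𝔪_D` were none of them, prime avoidance would give `x ∈ 𝔪_D` outside all
`𝔭ᵢ`, and a minimal prime `𝔮 ∋ x` (height `≤ 1`) would contain `f`, hence some `𝔭ⱼ`, hence equal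
it — contradicting `x ∉ 𝔭ⱼ`. So `ht 𝔪_D = 1` and every non-zero prime is `𝔪_D`.
[cite: Matsumura1987, Thm. 13.5] -/
theorem eq_maximalIdeal_of_forall_prime_mem {f : D} (hf0 : f ≠ 0) (hfm : f ∈ maximalIdeal D)
    (H : ∀ P : Ideal D, P.IsPrime → P ≠ ⊥ → f ∈ P) (P : Ideal D) [P.IsPrime] (hP : P ≠ ⊥) :
    P = maximalIdeal D := by
  classical
  -- the minimal primes over `(f)`
  set S := (Ideal.span {f} : Ideal D).minimalPrimes with hS
  have hSfin : S.Finite := Ideal.finite_minimalPrimes_of_isNoetherianRing D (Ideal.span {f})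
  have hSprime : ∀ q ∈ S, q.IsPrime := fun q hq => hq.1.1
  have hSle : ∀ q ∈ S, Ideal.span {f} ≤ q := fun q hq => hq.1.2
  have hSht : ∀ q ∈ S, q.height ≤ 1 := fun q hq =>
    Ideal.height_le_one_of_isPrincipal_of_mem_minimalPrimes (Ideal.span {f}) q hq
  have hSne : ∀ q ∈ S, q ≠ ⊥ := fun q hq h0 => hf0 (by
    have := hSle q hq (Ideal.mem_span_singleton_self f)
    rwa [h0, Ideal.mem_bot] at this)
  have hfle : Ideal.span {f} ≤ maximalIdeal D :=
    Ideal.span_le.mpr (Set.singleton_subset_iff.mpr hfm)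
  have hftop : Ideal.span {f} ≠ ⊤ :=
    ne_top_of_le_ne_top (Ideal.IsPrime.ne_top inferInstance) hfle
  obtain ⟨⟨q₀, hq₀⟩⟩ := Ideal.nonempty_minimalPrimes hftop
  -- `𝔪_D` is one of them
  have hmS : maximalIdeal D ∈ S := by
    by_contra hmS
    have hnot : ∀ q ∈ S, ¬ maximalIdeal D ≤ q := fun q hq hle => by
      haveI := hSprime q hq
      have := (IsLocalRing.le_maximalIdeal (Ideal.IsPrime.ne_top ‹q.IsPrime›)).antisymm hle
      exact hmS (this ▸ hq)
    -- prime avoidance: some `x ∈ 𝔪_D` avoids every `q ∈ S`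
    obtain ⟨x, hxm, hxS⟩ : ∃ x ∈ maximalIdeal D, ∀ q ∈ S, x ∉ q := by
      by_contra hcon
      have hsub : ((maximalIdeal D : Ideal D) : Set D) ⊆
          ⋃ q ∈ (hSfin.toFinset : Set (Ideal D)), ((id q : Ideal D) : Set D) := by
        intro x hx
        have : ∃ q ∈ S, x ∈ q := by
          by_contra h'
          exact hcon ⟨x, hx, fun q hq hxq => h' ⟨q, hq, hxq⟩⟩
        obtain ⟨q, hq, hxq⟩ := this
        exact Set.mem_biUnion (hSfin.mem_toFinset.mpr hq) hxq
      obtain ⟨q, hq, hle⟩ := (Ideal.subset_union_prime q₀ q₀ (f := id) (s := hSfin.toFinset)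
        (fun q hq _ _ => hSprime q (hSfin.mem_toFinset.mp hq))).mp hsub
      exact hnot q (hSfin.mem_toFinset.mp hq) hle
    have hx0 : x ≠ 0 := fun h => hxS q₀ hq₀ (h ▸ Submodule.zero_mem q₀)
    -- a minimal prime over `(x)` inside `𝔪_D`
    obtain ⟨r, hr, -⟩ := Ideal.exists_minimalPrimes_le
      (I := Ideal.span {x}) (J := maximalIdeal D)
      (Ideal.span_le.mpr (Set.singleton_subset_iff.mpr hxm))
    haveI hrp : r.IsPrime := hr.1.1
    have hxr : x ∈ r := hr.1.2 (Ideal.mem_span_singleton_self x)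
    have hr0 : r ≠ ⊥ := fun h => hx0 (by rwa [h, Ideal.mem_bot] at hxr)
    have hfr : f ∈ r := H r hrp hr0
    obtain ⟨q, hq, hqr⟩ := Ideal.exists_minimalPrimes_le (I := Ideal.span {f}) (J := r)
      (Ideal.span_le.mpr (Set.singleton_subset_iff.mpr hfr))
    haveI := hSprime q hq
    have hrht : r.height ≤ 1 :=
      Ideal.height_le_one_of_isPrincipal_of_mem_minimalPrimes (Ideal.span {x}) r hr
    have hqr' : q = r :=
      Ideal.eq_of_le_of_height_le q hqr (hrht.trans (one_le_height_of_ne_bot q (hSne q hq)))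
    exact hxS q hq (hqr' ▸ hxr)
  -- conclusion
  have hmht : (maximalIdeal D).height ≤ 1 := hSht _ hmS
  exact Ideal.eq_of_le_of_height_le P (IsLocalRing.le_maximalIdeal (Ideal.IsPrime.ne_top ‹_›))
    (hmht.trans (one_le_height_of_ne_bot P hP))

/-- Under the hypotheses of `eq_maximalIdeal_of_forall_prime_mem`, some power of the maximal
ideal lies in every non-zero principal ideal. [cite: Matsumura1987, Thm. 13.5] -/
theorem exists_maximalIdeal_pow_le_span {f : D} (hf0 : f ≠ 0) (hfm : f ∈ maximalIdeal D)
    (H : ∀ P : Ideal D, P.IsPrime → P ≠ ⊥ → f ∈ P) {g : D} (hg0 : g ≠ 0) :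
    ∃ N : ℕ, maximalIdeal D ^ N ≤ Ideal.span {g} := by
  refine Ideal.exists_pow_le_of_le_radical_of_fg ?_ (IsNoetherian.noetherian _)
  rw [Ideal.radical_eq_sInf, le_sInf_iff]
  rintro J ⟨hgJ, hJ⟩
  have hJ0 : J ≠ ⊥ := fun h => hg0 (by
    have := hgJ (Ideal.mem_span_singleton_self g)
    rwa [h, Ideal.mem_bot] at this)
  haveI := hJ
  exact (eq_maximalIdeal_of_forall_prime_mem hf0 hfm H J hJ0).ge

end OneDimensional

/-! ### Local `𝒪_L`-algebras with residue field `k_L` -/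

section Residue

variable {p : ℕ} [Fact p.Prime] (L : IntermediateField ℚ_[p] (PadicAlgCl p))
  {R : Type*} [CommRing R] [IsLocalRing R] [Algebra (intermediateFieldIntegers p L) R]

/-- If `𝒪_L → R → R/𝔪_R` is onto, the structure map is local: it maps `𝔪_{𝒪_L}` into `𝔪_R`
(the kernel of `𝒪_L → R/𝔪_R` is a maximal ideal of the local ring `𝒪_L`). [folklore] -/
theorem algebraMap_mem_maximalIdeal
    (hres : Function.Surjective ((residue R).comp (algebraMap (intermediateFieldIntegers p L) R)))
    {a : intermediateFieldIntegers p L} (ha : a ∈ maximalIdeal (intermediateFieldIntegers p L)) :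
    algebraMap (intermediateFieldIntegers p L) R a ∈ maximalIdeal R := by
  have hker : (RingHom.ker ((residue R).comp
      (algebraMap (intermediateFieldIntegers p L) R))).IsMaximal :=
    RingHom.ker_isMaximal_of_surjective _ hres
  have hker' := IsLocalRing.eq_maximalIdeal hker
  have : a ∈ RingHom.ker ((residue R).comp (algebraMap (intermediateFieldIntegers p L) R)) :=
    hker' ▸ ha
  rw [RingHom.mem_ker, RingHom.comp_apply, residue_eq_zero_iff] at this
  exact this

/-- In particular `p ∈ 𝔪_R`. [folklore] -/
theorem natCast_mem_maximalIdeal_of_residue_surjective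
    (hres : Function.Surjective ((residue R).comp (algebraMap (intermediateFieldIntegers p L) R))) :
    (p : R) ∈ maximalIdeal R := by
  have := algebraMap_mem_maximalIdeal L hres (intermediateFieldIntegers.natCast_mem_maximalIdeal L)
  rwa [map_natCast] at this

/-- `R = 𝒪_L + 𝔪_R` when `𝒪_L → R/𝔪_R` is onto. [folklore] -/
theorem exists_sub_algebraMap_mem_maximalIdeal
    (hres : Function.Surjective ((residue R).comp (algebraMap (intermediateFieldIntegers p L) R)))
    (r : R) : ∃ a : intermediateFieldIntegers p L,
      r - algebraMap (intermediateFieldIntegers p L) R a ∈ maximalIdeal R := by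
  obtain ⟨a, ha⟩ := hres (residue R r)
  refine ⟨a, ?_⟩
  rw [← residue_eq_zero_iff, map_sub, sub_eq_zero]
  exact ha.symm

/-- For a proper ideal `Q`, the quotient map `R → R/Q` sends `𝔪_R` into `𝔪_{R/Q}`. [folklore] -/
theorem mk_mem_maximalIdeal_quotient {Q : Ideal R} (hQ : Q ≠ ⊤) [IsLocalRing (R ⧸ Q)] {a : R}
    (ha : a ∈ maximalIdeal R) : Ideal.Quotient.mk Q a ∈ maximalIdeal (R ⧸ Q) := by
  rw [IsLocalRing.mem_maximalIdeal, mem_nonunits_iff]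
  intro hu
  obtain ⟨b, hb⟩ := hu.exists_right_inv
  obtain ⟨b, rfl⟩ := Ideal.Quotient.mk_surjective b
  rw [← map_mul, ← (Ideal.Quotient.mk Q).map_one, Ideal.Quotient.eq] at hb
  have h1 : a * b - 1 ∈ maximalIdeal R := (IsLocalRing.le_maximalIdeal hQ) hb
  have : (1 : R) ∈ maximalIdeal R := by
    have := (maximalIdeal R).sub_mem ((maximalIdeal R).mul_mem_right b ha) h1
    rwa [sub_sub_cancel] at this
  exact (maximalIdeal R).ne_top_iff_one.mp (Ideal.IsPrime.ne_top inferInstance) this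

end Residue

/-! ### Points separate elements -/

section Points

variable {p : ℕ} [Fact p.Prime] (L : IntermediateField ℚ_[p] (PadicAlgCl p))
  [Algebra (intermediateFieldIntegers p L) (PadicAlgCl p)]
  [IsScalarTower (intermediateFieldIntegers p L) L (PadicAlgCl p)]
  {R : Type*} [CommRing R]

/-- The structure map `𝒪_L → ℚ̄_p` is injective. [folklore] -/
theorem algebraMap_integers_padicAlgCl_injective :
    Function.Injective (algebraMap (intermediateFieldIntegers p L) (PadicAlgCl p)) := by
  rw [IsScalarTower.algebraMap_eq (intermediateFieldIntegers p L) L (PadicAlgCl p)]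
  exact (algebraMap L (PadicAlgCl p)).injective.comp (IsFractionRing.injective _ _)

omit [Fact p.Prime] in
/-- In a reduced ring without `p`-torsion, `r ≠ 0` implies that `r·p` is not nilpotent.
[folklore] -/
theorem not_isNilpotent_mul_natCast [IsReduced R] (htf : ∀ r : R, (p : R) * r = 0 → r = 0)
    {r : R} (hr : r ≠ 0) : ¬ IsNilpotent (r * p) := by
  rintro ⟨n, hn⟩
  rw [mul_pow] at hn
  have hpow : ∀ (k : ℕ) (s : R), (p : R) ^ k * s = 0 → s = 0 := by
    intro k
    induction k with
    | zero => intro s hs; simpa using hs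
    | succ k ih =>
      intro s hs
      rw [pow_succ, mul_assoc] at hs
      exact htf s (ih _ hs)
  have : r ^ n = 0 := hpow n (r ^ n) (by rwa [mul_comm] at hn)
  exact hr (IsReduced.eq_zero r ⟨n, this⟩)

variable [FiniteDimensional ℚ_[p] L] [IsLocalRing R] [IsNoetherianRing R]
  [Algebra (intermediateFieldIntegers p L) R]

/-- **`ℚ̄_p`-points separate elements.** Let `R` be a reduced noetherian local `𝒪_L`-algebra
without `p`-torsion whose residue field is `k_L` (`𝒪_L → R/𝔪_R` onto). Then for every `r ≠ 0`
there is an `𝒪_L`-algebra homomorphism `x : R → ℚ̄_p` with `x r ≠ 0`. See the module docstring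
for the proof. [cite: BarnetlambEtAl2014, §1.3–1.4] [cite: Matsumura1987, Thm. 8.4 and Thm. 13.5] -/
theorem exists_algHom_apply_ne_zero [IsReduced R] (htf : ∀ r : R, (p : R) * r = 0 → r = 0)
    (hres : Function.Surjective ((residue R).comp (algebraMap (intermediateFieldIntegers p L) R)))
    {r : R} (hr : r ≠ 0) :
    ∃ x : R →ₐ[intermediateFieldIntegers p L] PadicAlgCl p, x r ≠ 0 := by
  classical
  -- Step 1: `f = r p` is not nilpotent, so `R_f ≠ 0` has a maximal ideal
  have hfn : ¬ IsNilpotent (r * p) := not_isNilpotent_mul_natCast (p := p) htf hr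
  haveI : Nontrivial (Localization.Away (r * (p : R))) := by
    by_contra h
    rw [not_nontrivial_iff_subsingleton] at h
    obtain ⟨n, hn⟩ := (IsLocalization.subsingleton_iff (M := Submonoid.powers (r * (p : R)))
      (S := Localization.Away (r * (p : R)))).mp h
    exact hfn ⟨n, hn⟩
  obtain ⟨M, hM⟩ := Ideal.exists_maximal (Localization.Away (r * (p : R)))
  haveI := hM
  -- Step 2: its contraction `Q`, a prime missing `f`, maximal among such
  haveI hQp : (M.under R).IsPrime := inferInstance
  have hdisj : Disjoint ((Submonoid.powers (r * (p : R)) : Submonoid R) : Set R)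
      ((M.under R : Ideal R) : Set R) :=
    ((IsLocalization.isPrime_iff_isPrime_disjoint (Submonoid.powers (r * (p : R)))
      (Localization.Away (r * (p : R))) M).mp hM.isPrime).2
  have hfQ : r * p ∉ M.under R := fun h =>
    Set.disjoint_left.mp hdisj (Submonoid.mem_powers _) h
  have hpQ : (p : R) ∉ M.under R := fun h => hfQ ((M.under R).mul_mem_left r h)
  have hrQ : r ∉ M.under R := fun h => hfQ ((M.under R).mul_mem_right _ h)
  have hQmax : ∀ P : Ideal R, P.IsPrime → M.under R ≤ P → r * p ∉ P → P = M.under R := by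
    intro P hP hQP hfP
    have hdisjP : Disjoint ((Submonoid.powers (r * (p : R)) : Submonoid R) : Set R)
        (P : Set R) := by
      refine Set.disjoint_left.mpr ?_
      rintro _ ⟨n, rfl⟩ hn
      exact hfP (hP.mem_of_pow_mem n hn)
    haveI hPf : (P.map (algebraMap R (Localization.Away (r * (p : R))))).IsPrime :=
      IsLocalization.isPrime_of_isPrime_disjoint (Submonoid.powers (r * (p : R))) _ P hP hdisjP
    have hMle : M ≤ P.map (algebraMap R (Localization.Away (r * (p : R)))) := by
      rw [← IsLocalization.map_under (Submonoid.powers (r * (p : R)))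
        (Localization.Away (r * (p : R))) M]
      exact Ideal.map_mono hQP
    have hMeq : P.map (algebraMap R (Localization.Away (r * (p : R)))) = M :=
      (hM.eq_of_le hPf.ne_top hMle).symm
    have := IsLocalization.under_map_of_isPrime_disjoint (Submonoid.powers (r * (p : R)))
      (Localization.Away (r * (p : R))) hP hdisjP
    rw [← this, hMeq]
  -- Step 3: the noetherian local domain `D = R/Q`
  set Q : Ideal R := M.under R with hQ
  haveI : IsDomain (R ⧸ Q) := Ideal.Quotient.isDomain Q
  haveI : IsLocalRing (R ⧸ Q) :=
    IsLocalRing.of_surjective' (Ideal.Quotient.mk Q) Ideal.Quotient.mk_surjective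
  have hmk_mem : ∀ {a : R}, a ∈ maximalIdeal R → Ideal.Quotient.mk Q a ∈ maximalIdeal (R ⧸ Q) :=
    fun ha => mk_mem_maximalIdeal_quotient hQp.ne_top ha
  have hfbar0 : Ideal.Quotient.mk Q (r * p) ≠ 0 := fun h =>
    hfQ (Ideal.Quotient.eq_zero_iff_mem.mp h)
  have hpR : (p : R) ∈ maximalIdeal R := natCast_mem_maximalIdeal_of_residue_surjective L hres
  have hfbarm : Ideal.Quotient.mk Q (r * p) ∈ maximalIdeal (R ⧸ Q) :=
    hmk_mem ((maximalIdeal R).mul_mem_left r hpR)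
  -- every non-zero prime of `D` contains `f̄`
  have HD : ∀ P : Ideal (R ⧸ Q), P.IsPrime → P ≠ ⊥ → Ideal.Quotient.mk Q (r * p) ∈ P := by
    intro P hP hP0
    by_contra hfP
    have hP' : (P.comap (Ideal.Quotient.mk Q)).IsPrime := Ideal.comap_isPrime _ _
    have hQP : Q ≤ P.comap (Ideal.Quotient.mk Q) := fun a ha => by
      rw [Ideal.mem_comap, Ideal.Quotient.eq_zero_iff_mem.mpr ha]
      exact P.zero_mem
    have heq := hQmax _ hP' hQP hfP
    apply hP0
    rw [← Ideal.map_comap_of_surjective _ Ideal.Quotient.mk_surjective P, heq,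
      Ideal.map_quotient_self]
  -- Step 4: `𝔪_D^N ⊆ p D`
  have hpbar0 : (p : R ⧸ Q) ≠ 0 := fun h => hpQ (by
    rw [← map_natCast (Ideal.Quotient.mk Q), Ideal.Quotient.eq_zero_iff_mem] at h
    exact h)
  obtain ⟨N, hN⟩ := exists_maximalIdeal_pow_le_span hfbar0 hfbarm HD hpbar0
  -- Step 5: `D` is a finite `𝒪_L`-module (complete Nakayama over the complete ring `𝒪_L`)
  have halg : ∀ a : intermediateFieldIntegers p L, algebraMap (intermediateFieldIntegers p L)
      (R ⧸ Q) a = Ideal.Quotient.mk Q (algebraMap (intermediateFieldIntegers p L) R a) :=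
    fun _ => rfl
  have hloc : (maximalIdeal (intermediateFieldIntegers p L)).map
      (algebraMap (intermediateFieldIntegers p L) (R ⧸ Q)) ≤ maximalIdeal (R ⧸ Q) := by
    refine Ideal.map_le_iff_le_comap.mpr fun a ha => ?_
    rw [Ideal.mem_comap, halg]
    exact hmk_mem (algebraMap_mem_maximalIdeal L hres ha)
  have hresD : Function.Surjective ((residue (R ⧸ Q)).comp
      (algebraMap (intermediateFieldIntegers p L) (R ⧸ Q))) := by
    intro z
    obtain ⟨d, rfl⟩ := residue_surjective z
    obtain ⟨c, rfl⟩ := Ideal.Quotient.mk_surjective d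
    obtain ⟨a, ha⟩ := exists_sub_algebraMap_mem_maximalIdeal L hres c
    refine ⟨a, ?_⟩
    have hmem : Ideal.Quotient.mk Q c - algebraMap (intermediateFieldIntegers p L) (R ⧸ Q) a ∈
        maximalIdeal (R ⧸ Q) := by
      rw [halg, ← map_sub]
      exact hmk_mem ha
    have h0 := (residue_eq_zero_iff _).mpr hmem
    rw [map_sub, sub_eq_zero] at h0
    rw [RingHom.comp_apply]
    exact h0.symm
  have hprim : ∃ N, maximalIdeal (R ⧸ Q) ^ N ≤ (maximalIdeal (intermediateFieldIntegers p L)).map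
      (algebraMap (intermediateFieldIntegers p L) (R ⧸ Q)) := by
    refine ⟨N, hN.trans ?_⟩
    rw [Ideal.span_le, Set.singleton_subset_iff]
    have : (p : R ⧸ Q) = algebraMap (intermediateFieldIntegers p L) (R ⧸ Q) (p : _) := by
      rw [map_natCast]
    rw [SetLike.mem_coe, this]
    exact Ideal.mem_map_of_mem _ (intermediateFieldIntegers.natCast_mem_maximalIdeal L)
  haveI : Module.Finite (intermediateFieldIntegers p L) (R ⧸ Q) :=
    Literature.AlgebraicGeometry.Resolution.module_finite_of_isAdicComplete_of_residue_surjective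
      hloc hresD hprim
  -- Step 6: `D` is torsion-free over `𝒪_L`, hence algebraic, and maps to `ℚ̄_p`
  have hinjOD : Function.Injective (algebraMap (intermediateFieldIntegers p L) (R ⧸ Q)) := by
    rw [injective_iff_map_eq_zero]
    intro a ha
    by_contra ha0
    have hker : (RingHom.ker (algebraMap (intermediateFieldIntegers p L) (R ⧸ Q))).IsPrime :=
      RingHom.ker_isPrime _
    have hpk : (p : intermediateFieldIntegers p L) ∉
        RingHom.ker (algebraMap (intermediateFieldIntegers p L) (R ⧸ Q)) := by
      rw [RingHom.mem_ker, map_natCast]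
      exact hpbar0
    have hne : RingHom.ker (algebraMap (intermediateFieldIntegers p L) (R ⧸ Q)) ≠ ⊥ := fun h =>
      ha0 (by
        have : a ∈ RingHom.ker (algebraMap (intermediateFieldIntegers p L) (R ⧸ Q)) := ha
        rwa [h, Ideal.mem_bot] at this)
    have hmax := IsPrime.to_maximal_ideal (hpi := hker) hne
    have := IsLocalRing.eq_maximalIdeal hmax
    exact hpk (this ▸ intermediateFieldIntegers.natCast_mem_maximalIdeal L)
  haveI : Module.IsTorsionFree (intermediateFieldIntegers p L) (R ⧸ Q) :=
    (Module.isTorsionFree_iff_algebraMap_injective).mpr hinjOD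
  haveI : Module.IsTorsionFree (intermediateFieldIntegers p L) (PadicAlgCl p) :=
    (Module.isTorsionFree_iff_algebraMap_injective).mpr
      (algebraMap_integers_padicAlgCl_injective L)
  haveI : Algebra.IsAlgebraic (intermediateFieldIntegers p L) (R ⧸ Q) :=
    Algebra.IsAlgebraic.of_finite (intermediateFieldIntegers p L) (R ⧸ Q)
  haveI : Algebra.IsIntegral (intermediateFieldIntegers p L) (R ⧸ Q) :=
    Algebra.IsIntegral.of_finite (intermediateFieldIntegers p L) (R ⧸ Q)
  let ψ : (R ⧸ Q) →ₐ[intermediateFieldIntegers p L] PadicAlgCl p := IsAlgClosed.lift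
  -- `ψ` is injective: its kernel is a prime of `D` lying over `0`
  have hψ : Function.Injective ψ := by
    rw [injective_iff_map_eq_zero]
    intro d hd
    have hker0 : (RingHom.ker (ψ : (R ⧸ Q) →+* PadicAlgCl p)).comap
        (algebraMap (intermediateFieldIntegers p L) (R ⧸ Q)) = ⊥ := by
      refine le_bot_iff.mp fun a ha => ?_
      rw [Ideal.mem_comap, RingHom.mem_ker] at ha
      have ha' : algebraMap (intermediateFieldIntegers p L) (PadicAlgCl p) a = 0 := by
        rw [← ψ.commutes a]
        exact ha
      rw [Ideal.mem_bot]
      exact algebraMap_integers_padicAlgCl_injective L (by rw [ha', map_zero])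
    haveI : (RingHom.ker (ψ : (R ⧸ Q) →+* PadicAlgCl p)).IsPrime := RingHom.ker_isPrime _
    have hbot := Ideal.eq_bot_of_comap_eq_bot hker0
    have hd' : d ∈ RingHom.ker (ψ : (R ⧸ Q) →+* PadicAlgCl p) := hd
    rw [hbot, Ideal.mem_bot] at hd'
    exact hd'
  -- Step 7: the point `R → D → ℚ̄_p`
  refine ⟨ψ.comp (Ideal.Quotient.mkₐ (intermediateFieldIntegers p L) Q), fun hx => hrQ ?_⟩
  have h0 : Ideal.Quotient.mk Q r = 0 := hψ (by
    rw [map_zero]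
    exact hx)
  exact Ideal.Quotient.eq_zero_iff_mem.mp h0

/-- Equivalently: an element of `R` killed by every `ℚ̄_p`-point is zero.
[cite: BarnetlambEtAl2014, §1.3–1.4] -/
theorem eq_zero_of_forall_algHom_eq_zero [IsReduced R] (htf : ∀ r : R, (p : R) * r = 0 → r = 0)
    (hres : Function.Surjective ((residue R).comp (algebraMap (intermediateFieldIntegers p L) R)))
    {r : R} (h : ∀ x : R →ₐ[intermediateFieldIntegers p L] PadicAlgCl p, x r = 0) : r = 0 := by
  by_contra hr
  obtain ⟨x, hx⟩ := exists_algHom_apply_ne_zero L htf hres hr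
  exact hx (h x)

end Points

end Literature.NumberTheory.GaloisRepresentations

end
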